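import Mathlib
import Summits.AnomalousDissipation.AnomalousDissipation.Theorems.SoloBlindWeightedNeumann
import Summits.AnomalousDissipation.AnomalousDissipation.Theorems.SoloBlindCoupledShermanMorrison

/-!
# SoloBlind — invertibility of the coupled column operator of LEMMA P (assembly of kernels #249 and #256)

At a point `(x, g, κ)` of a pair box the frozen streak/roll column operator is
`𝒯 = T̂ - K' - c · e_k e_kᵀ`, where `T̂` is the site-shifted streak/roll block operator (invertible, with
Green's function `Ĝ = T̂⁻¹` enclosed by the Taylor-model engine), `K'` the coupling, and `c · e_k e_kᵀ` undoes
the site shift.  The certificate supplies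

* weights `w > 0` and `q < 1` with `∑ j, ‖(T̂⁻¹ K') m j‖ w j ≤ q w m` (engine L / L⁺: the regular part), and
* `𝔇 = 1 - c ((T̂ - K')⁻¹)_{kk} ≠ 0` (engine P: the dressed pair scalar, kernels #254/#255 give `𝔇 ≠ 0` on the box).

This file proves the finite-dimensional conclusion: `𝒯` is invertible.  (ENGINE-L-SPEC §8, PLAN §121.18–§121.20.)
-/

namespace Summit.AnomalousDissipation.SoloBlind.ColumnInvertible

open Matrix

variable {n : ℕ}

/-- Regular part: if `T̂` is invertible and `L = T̂⁻¹ K'` passes the weighted Schur test with `q < 1`, then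
`T̂ - K' = T̂ (1 - L)` is invertible. -/
theorem isUnit_sub_coupling (T K : Matrix (Fin n) (Fin n) ℂ) (hT : IsUnit T) {w : Fin n → ℝ} {q : ℝ}
    (hw : ∀ m, 0 < w m) (hq : q < 1) (hrow : ∀ m, ∑ j, ‖(T⁻¹ * K) m j‖ * w j ≤ q * w m) :
    IsUnit (T - K) := by
  have h1 : IsUnit (1 - T⁻¹ * K) := WeightedNeumann.isUnit_one_sub hw hq hrow
  have hdet : IsUnit T.det := (Matrix.isUnit_iff_isUnit_det T).mp hT
  have h2 : T - K = T * (1 - T⁻¹ * K) := by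
    rw [mul_sub, mul_one, ← mul_assoc, Matrix.mul_nonsing_inv T hdet, one_mul]
  rw [h2]
  exact hT.mul h1

/-- The coupled column operator `T̂ - K' - c · e_k e_kᵀ` is invertible as soon as the regular part passes the
weighted Schur test and the dressed pair scalar `𝔇 = 1 - c ((T̂ - K')⁻¹)_{kk}` is nonzero. -/
theorem column_isUnit (T K : Matrix (Fin n) (Fin n) ℂ) (c : ℂ) (k : Fin n) (hT : IsUnit T)
    {w : Fin n → ℝ} {q : ℝ} (hw : ∀ m, 0 < w m) (hq : q < 1)
    (hrow : ∀ m, ∑ j, ‖(T⁻¹ * K) m j‖ * w j ≤ q * w m)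
    (hD : 1 - c * ((T - K)⁻¹) k k ≠ 0) :
    IsUnit (T - K - c • vecMulVec (Pi.single k 1) (Pi.single k 1)) :=
  CoupledShermanMorrison.isUnit_sub_rank_one (T - K) (isUnit_sub_coupling T K hT hw hq hrow) c k hD

/-- Consequently the column system `𝒯 s = f` has a unique solution for every right-hand side. -/
theorem column_existsUnique (T K : Matrix (Fin n) (Fin n) ℂ) (c : ℂ) (k : Fin n) (hT : IsUnit T)
    {w : Fin n → ℝ} {q : ℝ} (hw : ∀ m, 0 < w m) (hq : q < 1)
    (hrow : ∀ m, ∑ j, ‖(T⁻¹ * K) m j‖ * w j ≤ q * w m)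
    (hD : 1 - c * ((T - K)⁻¹) k k ≠ 0) (f : Fin n → ℂ) :
    ∃! s : Fin n → ℂ, (T - K - c • vecMulVec (Pi.single k 1) (Pi.single k 1)) *ᵥ s = f := by
  have hU := column_isUnit T K c k hT hw hq hrow hD
  obtain ⟨s, hs⟩ := (mulVec_surjective_iff_isUnit.mpr hU) f
  refine ⟨s, hs, fun t ht => ?_⟩
  exact (mulVec_injective_iff_isUnit.mpr hU) (ht.trans hs.symm)

end Summit.AnomalousDissipation.SoloBlind.ColumnInvertible
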